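import Literature.NumberTheory.Automorphic.StrongArtinGL2LocalRigidityUnitProofs
import Literature.NumberTheory.Automorphic.StrongArtinGL2GlobalQuotientMeromorphicProofs
import HarnessLib

/-!
# Gelbart's Prop. 4.1 from the global analytic package, with no genericity hypothesis
(pure proofs; companion to `Automorphic/StrongArtinGL2GlobalQuotientProofs`,
`Automorphic/StrongArtinGL2GlobalQuotientMeromorphicProofs` and
`Automorphic/StrongArtinGL2LocalRigidityUnitProofs`)

`frobSatakeCompatibleAt_of_isPiOfArtinRep_of_meromorphic_functional_equations`
(`StrongArtinGL2GlobalQuotientMeromorphicProofs`) reduces the named fact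
`Literature.NumberTheory.Automorphic.frobSatakeCompatibleAt_of_isPiOfArtinRep` (Gelbart 1997,
Prop. 4.1) to the existence, for each cuspidal `π = π(σ)` with Satake parameter `α` at `v`, of the
analytic data of Jacquet–Langlands 1970, pp. 209–210 (four meromorphic functions with their
functional equations and Euler-product agreements) **and** the genericity of `α` (`a ≠ q_v b`).
Using the genericity-free local rigidity of `StrongArtinGL2LocalRigidityUnitProofs` (the full
zero/pole comparison of Jacquet–Langlands p. 211, which also tracks the dual Artin factor
`L(1 - s, σ̃_v)` and uses `|Frobenius eigenvalues| = 1`), this file removes the genericity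
hypothesis: the package now displays the Euler factor at `v` of a second Artin representation `σ'`
(the contragredient `σ̃`) on the contragredient side, and asks both `ε`-factors to be nowhere zero
and all four reciprocal archimedean factors to vanish only on finitely many horizontal lines — as
products of `Γ_ℝ(s + m)⁻¹` do.

* `frobSatake_of_global_functional_equations_of_norm_eq_one` — Prop. 4.1 at `v` from the package
  with exceptional set `P` (as in `frobSatake_of_global_functional_equations`), no genericity.
* `frobSatake_of_meromorphic_functional_equations_of_norm_eq_one` — the same in the
  Mathlib-`Meromorphic` form with archimedean data `μ_π, μ_σ, μ_π', μ_σ'`.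
* `frobSatakeCompatibleAt_of_isPiOfArtinRep_of_analytic_package` — **the named fact from the pure
  analytic package**: for every cuspidal `π = π(σ)` with Satake parameter `α` at `v` there exist
  `σ'`, meromorphic `Λ_π, Λ_σ, Λ_π', Λ_σ'`, continuous nowhere-zero `ε_π, ε_σ`, multisets
  `μ_π, μ_σ, μ_π', μ_σ'` and `c` with the two Euler-product agreements on `re s > c`, the two
  functional equations, and `Λ_π' ≠ 0` at a point of analyticity.  Nothing about `α` is assumed
  (`0 ∉ α` is `hasSatakeParamAt_ne_zero_holds`; genericity is not needed).

What the package encodes, and what the tree lacks (so that the named fact stays a named fact):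
the functional equations with Euler products of `L(s, ω ⊗ π)` for the cuspidal Borel–Jacquet
datum `π` and an idèle class character `ω` (Jacquet–Langlands Thm. 11.1, Cor. 11.2), of
`L(s, ω ⊗ σ)` (Artin–Brauer; the tree's named fact `artin_functional_equation`), and the existence
of `ω` unramified at `v` and so ramified at the other exceptional finite places that all local
factors there are `1` (Lemma 12.5).

No new definition and no named fact is introduced (D-0026).

## References

* H. Jacquet, R. P. Langlands, *Automorphic Forms on GL(2)*, LNM 114 (1970): proof of Thm. 12.2,
  pp. 209–211 (retypeset ed.), Thm. 11.1, Cor. 11.2, Lemma 12.5. [JacquetLanglands1970]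
* S. Gelbart, *Three lectures on the modularity of `ρ̄_{E,3}` …* (1997): Prop. 4.1. [Gelbart1997]
-/

noncomputable section

open scoped MatrixGroups NumberField Polynomial
open NumberField IsDedekindDomain Field Polynomial Complex Filter Topology Set
open Literature.NumberTheory.GaloisRepresentations (ArtinRep FramedArtinRep)
open Literature.NumberTheory.LFunctions

namespace Literature.NumberTheory.Automorphic

section OnePlace

variable {F : Type*} [Field F] [NumberField F]

/-- **Prop. 4.1 at `v` from the global analytic package, no genericity** (Jacquet–Langlands 1970,
pp. 209–211).  As `frobSatake_of_global_functional_equations`, with the following changes: the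
second Euler-product agreement displays the Euler factor at `v` of a second Artin representation
`σ'` (the contragredient), `Λ_π'(s) ∏_{a ∈ α}(1 - a⁻¹ q^{-s}) Γ_π'(s) = Λ_σ'(s) L_v(σ', q^{-s}) Γ_σ'(s)`;
both `ε_π, ε_σ` are nowhere zero; all four entire `Γ_•` vanish only on finitely many horizontal
lines; and **no condition relates the elements of `α`** (two non-zero numbers).  Proof:
`quotient_of_functional_equations`, then `frobSatake_of_local_identity_of_norm_eq_one` with
`Φ = ε_σ Γ_σ Γ_π'(1 - ·)`, `Ψ = ε_π Γ_π Γ_σ'(1 - ·)` and `E` = the zeros of `Φ Ψ`.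
[cite: JacquetLanglands1970, proof of Thm. 12.2, pp. 209–211] -/
theorem frobSatake_of_global_functional_equations_of_norm_eq_one (σ σ' : FramedArtinRep F 2)
    (v : HeightOneSpectrum (𝓞 F)) {α : Multiset ℂ} (hcard : Multiset.card α = 2)
    (h0 : (0 : ℂ) ∉ α)
    {P : Set ℂ} (hPc : IsClosed P) (hP : P.Countable) (hPs : ∀ s ∈ P, 1 - s ∈ P)
    {Λπ Λσ Λπ' Λσ' : ℂ → ℂ} (hΛπ : DifferentiableOn ℂ Λπ Pᶜ) (hΛσ : DifferentiableOn ℂ Λσ Pᶜ)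
    (hΛπ' : DifferentiableOn ℂ Λπ' Pᶜ) (hΛσ' : DifferentiableOn ℂ Λσ' Pᶜ)
    {Γπ Γσ Γπ' Γσ' επ εσ : ℂ → ℂ} (hΓπ : Differentiable ℂ Γπ) (hΓσ : Differentiable ℂ Γσ)
    (hΓπ' : Differentiable ℂ Γπ') (hΓσ' : Differentiable ℂ Γσ') (hεπ : Continuous επ)
    (hεσ : Continuous εσ) (hεπ0 : ∀ s, επ s ≠ 0) (hεσ0 : ∀ s, εσ s ≠ 0)
    (hYπ : ∃ Y : Set ℝ, Y.Finite ∧ ∀ s, Γπ s = 0 → s.im ∈ Y)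
    (hYσ : ∃ Y : Set ℝ, Y.Finite ∧ ∀ s, Γσ s = 0 → s.im ∈ Y)
    (hYπ' : ∃ Y : Set ℝ, Y.Finite ∧ ∀ s, Γπ' s = 0 → s.im ∈ Y)
    (hYσ' : ∃ Y : Set ℝ, Y.Finite ∧ ∀ s, Γσ' s = 0 → s.im ∈ Y)
    {c : ℝ}
    (hE : ∀ s, c < s.re → s ∉ P →
      Λπ s * ((α.map fun a => eulerTerm v.residueCard a s).prod * Γπ s) =
        Λσ s * ((σ.toArtinRep.eulerFactorAt v).eval ((v.residueCard : ℂ) ^ (-s)) * Γσ s))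
    (hE' : ∀ s, c < s.re → s ∉ P →
      Λπ' s * ((α.map fun a => eulerTerm v.residueCard a⁻¹ s).prod * Γπ' s) =
        Λσ' s * ((σ'.toArtinRep.eulerFactorAt v).eval ((v.residueCard : ℂ) ^ (-s)) * Γσ' s))
    (hFπ : ∀ s, s ∉ P → Λπ s = επ s * Λπ' (1 - s))
    (hFσ : ∀ s, s ∉ P → Λσ s = εσ s * Λσ' (1 - s))
    (hNV : ∃ s, s ∉ P ∧ Λπ' s ≠ 0) :
    σ.IsUnramifiedAt v ∧ σ.HasFrobCharpolyAt v (satakePolynomial α) := by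
  have hq : 1 < v.residueCard := v.one_lt_residueCard
  have hq0 : v.residueCard ≠ 0 := by omega
  -- the local factors at `v` are entire
  have hPπ : Differentiable ℂ fun s : ℂ => (α.map fun a => eulerTerm v.residueCard a s).prod :=
    differentiable_multiset_prod_eulerTerm hq0 α
  have hPπ' : Differentiable ℂ fun s : ℂ => (α.map fun a => eulerTerm v.residueCard a⁻¹ s).prod := by
    have h := differentiable_multiset_prod_eulerTerm hq0 (α.map fun a => a⁻¹)
    simp only [Multiset.map_map, Function.comp_def] at h
    exact h
  have hcpow : Differentiable ℂ fun s : ℂ => (v.residueCard : ℂ) ^ (-s) :=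
    differentiable_neg.const_cpow (Or.inl (Nat.cast_ne_zero.mpr hq0))
  have hPσ : Differentiable ℂ fun s : ℂ =>
      (σ.toArtinRep.eulerFactorAt v).eval ((v.residueCard : ℂ) ^ (-s)) :=
    (Polynomial.differentiable (σ.toArtinRep.eulerFactorAt v)).comp hcpow
  have hPσ' : Differentiable ℂ fun s : ℂ =>
      (σ'.toArtinRep.eulerFactorAt v).eval ((v.residueCard : ℂ) ^ (-s)) :=
    (Polynomial.differentiable (σ'.toArtinRep.eulerFactorAt v)).comp hcpow
  -- the quotient of the functional equations (Jacquet–Langlands p. 209)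
  have hid := quotient_of_functional_equations hPc hP hPs hΛπ hΛσ hΛπ' hΛσ' (hPπ.fun_mul hΓπ)
    (hPσ.fun_mul hΓσ) (hPπ'.fun_mul hΓπ') (hPσ'.fun_mul hΓσ') hεπ hεσ hE hE' hFπ hFσ hNV
  -- the exceptional set: zeros of `Φ Ψ`, on finitely many horizontal lines
  obtain ⟨Yπ, hYπf, hYπ⟩ := hYπ
  obtain ⟨Yσ, hYσf, hYσ⟩ := hYσ
  obtain ⟨Yπ', hYπ'f, hYπ'⟩ := hYπ'
  obtain ⟨Yσ', hYσ'f, hYσ'⟩ := hYσ'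
  have h1s : Continuous fun s : ℂ => 1 - s := continuous_const.sub continuous_id
  have hΦc : Continuous fun s => εσ s * Γσ s * Γπ' (1 - s) :=
    (hεσ.mul hΓσ.continuous).mul (hΓπ'.continuous.comp h1s)
  have hΨc : Continuous fun s => επ s * Γπ s * Γσ' (1 - s) :=
    (hεπ.mul hΓπ.continuous).mul (hΓσ'.continuous.comp h1s)
  have hΦim : ∀ s : ℂ, εσ s * Γσ s * Γπ' (1 - s) = 0 → s.im ∈ Yσ ∪ (fun y => -y) '' Yπ' := by
    intro s hs
    rcases mul_eq_zero.mp hs with h | h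
    · rcases mul_eq_zero.mp h with h | h
      · exact absurd h (hεσ0 s)
      · exact Or.inl (hYσ s h)
    · exact Or.inr ⟨(1 - s).im, hYπ' _ h, by simp⟩
  have hΨim : ∀ s : ℂ, επ s * Γπ s * Γσ' (1 - s) = 0 → s.im ∈ Yπ ∪ (fun y => -y) '' Yσ' := by
    intro s hs
    rcases mul_eq_zero.mp hs with h | h
    · rcases mul_eq_zero.mp h with h | h
      · exact absurd h (hεπ0 s)
      · exact Or.inl (hYπ s h)
    · exact Or.inr ⟨(1 - s).im, hYσ' _ h, by simp⟩
  have hEfin : ∀ c : ℂ, c ≠ 0 →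
      {s | s ∈ {s : ℂ | (εσ s * Γσ s * Γπ' (1 - s)) * (επ s * Γπ s * Γσ' (1 - s)) = 0} ∧
        eulerTerm v.residueCard c s = 0}.Finite := fun c _ =>
    (finite_setOf_eulerTerm_eq_zero_and_im_mem hq c
      ((hYσf.union (hYπ'f.image _)).union (hYπf.union (hYσ'f.image _)))).subset
      fun s ⟨hsE, hs0⟩ => ⟨hs0, by
        rcases mul_eq_zero.mp hsE with h | h
        · exact Or.inl (hΦim s h)
        · exact Or.inr (hΨim s h)⟩
  refine frobSatake_of_local_identity_of_norm_eq_one σ σ' v hcard h0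
    (isClosed_eq (hΦc.mul hΨc) continuous_const) hEfin hΦc.continuousOn hΨc.continuousOn
    (fun s hs h => hs (mul_eq_zero_of_left h _)) (fun s hs h => hs (mul_eq_zero_of_right _ h))
    fun s _ => ?_
  have h := hid s
  beta_reduce at h
  linear_combination h

/-- **Prop. 4.1 at `v` from meromorphic functional equations, no genericity** (Jacquet–Langlands
1970, pp. 209–211, in the form delivered by the tree's L-function predicates).  As
`frobSatake_of_meromorphic_functional_equations`, with a second Artin representation `σ'` whose
Euler factor at `v` is displayed on the contragredient side
(`Λ_π'(s) ∏_{a ∈ α}(1 - a⁻¹ q^{-s}) ∏_{m ∈ μ_π'} Γ_ℝ(s + m)⁻¹ = Λ_σ'(s) L_v(σ', q^{-s}) ∏_{m ∈ μ_σ'} Γ_ℝ(s + m)⁻¹`),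
both `ε_π, ε_σ` nowhere zero, and no condition on the two non-zero numbers in `α`.
[cite: JacquetLanglands1970, proof of Thm. 12.2, pp. 209–211] -/
theorem frobSatake_of_meromorphic_functional_equations_of_norm_eq_one (σ σ' : FramedArtinRep F 2)
    (v : HeightOneSpectrum (𝓞 F)) {α : Multiset ℂ} (hcard : Multiset.card α = 2)
    (h0 : (0 : ℂ) ∉ α)
    {Λπ Λσ Λπ' Λσ' : ℂ → ℂ} (hΛπ : Meromorphic Λπ) (hΛσ : Meromorphic Λσ)
    (hΛπ' : Meromorphic Λπ') (hΛσ' : Meromorphic Λσ') (μπ μσ μπ' μσ' : Multiset ℂ)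
    {επ εσ : ℂ → ℂ} (hεπ : Continuous επ) (hεσ : Continuous εσ) (hεπ0 : ∀ s, επ s ≠ 0)
    (hεσ0 : ∀ s, εσ s ≠ 0) {c : ℝ}
    (hE : ∀ s : ℂ, c < s.re →
      Λπ s * ((α.map fun a => eulerTerm v.residueCard a s).prod *
          (μπ.map fun m => (Gammaℝ (s + m))⁻¹).prod) =
        Λσ s * ((σ.toArtinRep.eulerFactorAt v).eval ((v.residueCard : ℂ) ^ (-s)) *
          (μσ.map fun m => (Gammaℝ (s + m))⁻¹).prod))
    (hE' : ∀ s : ℂ, c < s.re →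
      Λπ' s * ((α.map fun a => eulerTerm v.residueCard a⁻¹ s).prod *
          (μπ'.map fun m => (Gammaℝ (s + m))⁻¹).prod) =
        Λσ' s * ((σ'.toArtinRep.eulerFactorAt v).eval ((v.residueCard : ℂ) ^ (-s)) *
          (μσ'.map fun m => (Gammaℝ (s + m))⁻¹).prod))
    (hFπ : ∀ s, Λπ s = επ s * Λπ' (1 - s)) (hFσ : ∀ s, Λσ s = εσ s * Λσ' (1 - s))
    (hNV : ∃ s, AnalyticAt ℂ Λπ' s ∧ Λπ' s ≠ 0) :
    σ.IsUnramifiedAt v ∧ σ.HasFrobCharpolyAt v (satakePolynomial α) := by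
  obtain ⟨P, hPc, hP, hPs, hPa⟩ := exists_isClosed_countable_analyticAt hΛπ hΛσ hΛπ' hΛσ'
  have hNV' : ∃ s, s ∉ P ∧ Λπ' s ≠ 0 := by
    obtain ⟨s₀, hs₀a, hs₀⟩ := hNV
    obtain ⟨s, hsP, hs⟩ := (Set.Countable.dense_compl ℂ hP).inter_nhds_nonempty
      (hs₀a.continuousAt.preimage_mem_nhds (isOpen_ne.mem_nhds hs₀))
    exact ⟨s, hsP, hs⟩
  have hd : ∀ {Λ : ℂ → ℂ}, (∀ s, s ∉ P → AnalyticAt ℂ Λ s) → DifferentiableOn ℂ Λ Pᶜ :=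
    fun h s hs => (h s hs).differentiableAt.differentiableWithinAt
  exact frobSatake_of_global_functional_equations_of_norm_eq_one σ σ' v hcard h0 hPc hP hPs
    (hd fun s hs => (hPa s hs).1) (hd fun s hs => (hPa s hs).2.1)
    (hd fun s hs => (hPa s hs).2.2.1) (hd fun s hs => (hPa s hs).2.2.2)
    (Γπ := fun s => (μπ.map fun m => (Gammaℝ (s + m))⁻¹).prod)
    (Γσ := fun s => (μσ.map fun m => (Gammaℝ (s + m))⁻¹).prod)
    (Γπ' := fun s => (μπ'.map fun m => (Gammaℝ (s + m))⁻¹).prod)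
    (Γσ' := fun s => (μσ'.map fun m => (Gammaℝ (s + m))⁻¹).prod)
    (differentiable_multiset_prod_Gammaℝ_inv μπ) (differentiable_multiset_prod_Gammaℝ_inv μσ)
    (differentiable_multiset_prod_Gammaℝ_inv μπ') (differentiable_multiset_prod_Gammaℝ_inv μσ')
    hεπ hεσ hεπ0 hεσ0
    ⟨_, finite_image_neg_im μπ, fun s hs => im_mem_of_multiset_prod_Gammaℝ_inv_eq_zero μπ hs⟩
    ⟨_, finite_image_neg_im μσ, fun s hs => im_mem_of_multiset_prod_Gammaℝ_inv_eq_zero μσ hs⟩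
    ⟨_, finite_image_neg_im μπ', fun s hs => im_mem_of_multiset_prod_Gammaℝ_inv_eq_zero μπ' hs⟩
    ⟨_, finite_image_neg_im μσ', fun s hs => im_mem_of_multiset_prod_Gammaℝ_inv_eq_zero μσ' hs⟩
    (fun s hs _ => hE s hs) (fun s hs _ => hE' s hs) (fun s _ => hFπ s) (fun s _ => hFσ s) hNV'

end OnePlace

/-! ### The named fact from the pure analytic package -/

section NamedFact

open scoped Classical

/-- **Gelbart's Prop. 4.1 from the pure analytic package.**  The named fact
`frobSatakeCompatibleAt_of_isPiOfArtinRep` follows from the statement — displayed inline as the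
hypothesis `H`, which assumes **nothing about `α`** — that whenever the cuspidal `π = π(σ)` has
Satake parameter `α` at the finite place `v` (`q = N v`), there are an Artin representation `σ'`
(the contragredient of `σ`), meromorphic functions `Λ_π, Λ_σ, Λ_π', Λ_σ'` on `ℂ`, continuous
nowhere-zero `ε_π, ε_σ`, multisets `μ_π, μ_σ, μ_π', μ_σ'` and a real `c` such that
(i) for `re s > c`, `Λ_π(s) ∏_{a ∈ α}(1 - a q^{-s}) ∏_{m ∈ μ_π} Γ_ℝ(s + m)⁻¹ = Λ_σ(s) L_v(σ, q^{-s}) ∏_{m ∈ μ_σ} Γ_ℝ(s + m)⁻¹`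
and `Λ_π'(s) ∏_{a ∈ α}(1 - a⁻¹ q^{-s}) ∏_{m ∈ μ_π'} Γ_ℝ(s + m)⁻¹ = Λ_σ'(s) L_v(σ', q^{-s}) ∏_{m ∈ μ_σ'} Γ_ℝ(s + m)⁻¹`;
(ii) `Λ_π(s) = ε_π(s) Λ_π'(1 - s)` and `Λ_σ(s) = ε_σ(s) Λ_σ'(1 - s)` for all `s`;
(iii) `Λ_π'(s₀) ≠ 0` at some point `s₀` of analyticity.
In Jacquet–Langlands 1970, pp. 209–210, these are: the completed L-functions `L(s, ω ⊗ π)`,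
`L(s, ω ⊗ σ)`, `L(s, ω⁻¹ ⊗ π̃)`, `L(s, ω⁻¹ ⊗ σ̃)` for an idèle class character `ω` trivial at `v`
(a value `ω_v(ϖ_v) = ζ ≠ 1` is absorbed by the shift `s ↦ s + log ζ / log q`) and so ramified at the
other exceptional finite places that all local factors there are `1` (Lemma 12.5), with their
Euler products (whose factors at the remaining places agree because `π = π(σ)` there) and
functional equations (Thm. 11.1, Cor. 11.2; Artin–Brauer).  `0 ∉ α` is the theorem
`hasSatakeParamAt_ne_zero_holds`; the genericity of `α` is not needed
(`frobSatake_of_local_identity_of_norm_eq_one`).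
[cite: JacquetLanglands1970, proof of Thm. 12.2, pp. 209–211] [cite: Gelbart1997, Prop. 4.1] -/
theorem frobSatakeCompatibleAt_of_isPiOfArtinRep_of_analytic_package
    (H : ∀ {F : Type} [Field F] [NumberField F] (hcpt : isCompact_glFiniteIntegralLevel 2 F)
      (σ : FramedArtinRep F 2) (π : CuspidalAutomorphicRepData 2 F hcpt),
      IsPiOfArtinRep σ π.1 → ∀ (v : HeightOneSpectrum (𝓞 F)) (α : Multiset ℂ),
        π.1.HasSatakeParamAt v α →
        ∃ (σ' : FramedArtinRep F 2) (Λπ Λσ Λπ' Λσ' επ εσ : ℂ → ℂ) (μπ μσ μπ' μσ' : Multiset ℂ)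
          (c : ℝ),
          Meromorphic Λπ ∧ Meromorphic Λσ ∧ Meromorphic Λπ' ∧ Meromorphic Λσ' ∧
          Continuous επ ∧ Continuous εσ ∧ (∀ s, επ s ≠ 0) ∧ (∀ s, εσ s ≠ 0) ∧
          (∀ s : ℂ, c < s.re →
            Λπ s * ((α.map fun a => eulerTerm v.residueCard a s).prod *
                (μπ.map fun m => (Gammaℝ (s + m))⁻¹).prod) =
              Λσ s * ((σ.toArtinRep.eulerFactorAt v).eval ((v.residueCard : ℂ) ^ (-s)) *
                (μσ.map fun m => (Gammaℝ (s + m))⁻¹).prod)) ∧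
          (∀ s : ℂ, c < s.re →
            Λπ' s * ((α.map fun a => eulerTerm v.residueCard a⁻¹ s).prod *
                (μπ'.map fun m => (Gammaℝ (s + m))⁻¹).prod) =
              Λσ' s * ((σ'.toArtinRep.eulerFactorAt v).eval ((v.residueCard : ℂ) ^ (-s)) *
                (μσ'.map fun m => (Gammaℝ (s + m))⁻¹).prod)) ∧
          (∀ s, Λπ s = επ s * Λπ' (1 - s)) ∧ (∀ s, Λσ s = εσ s * Λσ' (1 - s)) ∧
          (∃ s, AnalyticAt ℂ Λπ' s ∧ Λπ' s ≠ 0)) :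
    frobSatakeCompatibleAt_of_isPiOfArtinRep := by
  intro F _ _ hcpt σ π hπ v α hα
  obtain ⟨σ', Λπ, Λσ, Λπ', Λσ', επ, εσ, μπ, μσ, μπ', μσ', c, hΛπ, hΛσ, hΛπ', hΛσ', hεπ, hεσ,
    hεπ0, hεσ0, hE, hE', hFπ, hFσ, hNV⟩ := H hcpt σ π hπ v α hα
  have h0 : (0 : ℂ) ∉ α := fun h => hasSatakeParamAt_ne_zero_holds hα 0 h rfl
  exact frobSatake_of_meromorphic_functional_equations_of_norm_eq_one σ σ' v hα.card_eq h0
    hΛπ hΛσ hΛπ' hΛσ' μπ μσ μπ' μσ' hεπ hεσ hεπ0 hεσ0 hE hE' hFπ hFσ hNV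

end NamedFact

end Literature.NumberTheory.Automorphic
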